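import Summits.QuantumFields.BalabanUV.T4Continuum.Support.NE7K1LinWalkExpansion
import Summits.QuantumFields.BalabanUV.T4Continuum.Support.NE7K1LinWalkCommutator
import Summits.QuantumFields.BalabanUV.T4Continuum.Support.NE7K1LinWalkBox

/-!
# NE7K1LinWalkFineOp — row NE7 (node U5), candidate route HOM, path H1L, cell K1-lin(s): B4 (2.12)–(2.13) ∕ (2.22) AT `A = 0` IN KERNEL —
# THE RANDOM-WALK EXPANSION OF BAŁABAN's PROPAGATOR `G_k(Ω,0) = (−Δ^{η,N}_Ω + aQ_k*Q_k)⁻¹` ON AN ALIGNED BOX CONVERGES FOR `M ≥ M₀(d,a)`,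
# UNIFORMLY IN THE MESH `η = 1∕n` AND IN THE BOX, WITH GEOMETRIC DECAY ACROSS `M`-CUBES

Lineage `b2b-balaban-t4-ne7-p2` (CRUX PROVER NE7 #2), generation 68; series (RW) file 8 = the ASSEMBLY of files 1–7:
`NE7K1LinWalkParametrix` (identity `P·G₀ = 1 − R`, locality), `NE7K1LinWalkSmallness` + `NE7K1LinWalkExpansion` (‖R‖ small ⇒ (2.12) converges,
`B4RandomWalk213.lattice_walk_decay_bound` BY NAME), `NE7K1LinWalkCommutator` ((H-comm) for `fineOpR`), `NE7K1LinWalkProfile` ∕ `…Cubes` ∕ `…Box`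
(the cut-offs and regions on the aligned box).  [Balaban1983RegularityDecay] = T. Bałaban, Commun. Math. Phys. 89 (1983) 571–597, §2.

THE INSTANCE.  Mesh `1∕n` (`n ≥ 1`), cube scale `M ≥ 3` blocks (`W = M·n` sites), the box `R = Π_μ[0,(2K_μ+1)Mn)` (a union of `n`-blocks,
any `K ∈ ℕ^{d+1}`), `a > 0`; `P = fineOpR n a 0 R = n²(−Δ^N_R) + (a∕n^{d+1})1_{same n-block}` (B4 (1.6) at `A = 0`, `B4Lower18`); labels
`J ∈ Π_μ{0..K_μ}` at positions `J ∈ ℤ^{d+1}`; cut-offs `l_J = cut (Mn) J` (file 6), `r_J = 1_{S_J}`, regions `S_J = region R (Mn) n J` (file 7).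
Every hypothesis of `NE7K1LinWalkExpansion.inv_entry_decay` is DISCHARGED (`§2`): coercivity `min(2,a)` (`B4Lower18.lower18_zero` = B4 (1.8)
at A = 0), cut-offs live on their regions (range `n` of `P`), `Σ_J l_J r_J ≡ 1`, disjointness of non-adjacent regions (`2n < Mn`), overlap
and covering numbers `≤ 3^{d+1}` (`B4RandomWalk213.card_cubeAdj_le`), (H-comm) with the MESH-FREE constants
`α² = 192(d+1)∕M²`, `β² = 3(1024(d+1)²∕M⁴ + 16a²(d+1)²∕M²)`, separation of labels from separation of sites.

* **`hasSum_fineOpR_walk`** — for `3^{d+1}·τ < 1`, `τ = √(α²∕σ′ + β²∕σ′²)`, `σ′ = min(min(2,a),1)`: `G_k(Ω,0) = Σ_{n≥0} G₀Rⁿ` converges in the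
  `ℓ²`-operator norm — B4 (2.12) *"the series in the representation (2.12) is convergent"* AT A = 0, AS A THEOREM («for M sufficiently
  large»: the threshold is explicit in `d, a` and free of `n` and of the box).
* **`fineOpR_inv_entry_decay`** — under the same smallness, for sites `x, y` of the box with `|x_μ − y_μ| ≥ (2N+3)Mn + n` in some
  coordinate (`N ≥ 1`): `|G_k(Ω,0)(x,y)| ≤ 3^{d+1}·σ′⁻¹·τ·3^{d+1}·(3^{d+1}τ)^{N−1}∕(1 − 3^{d+1}τ)` — B4 (2.22)∕(2.30)'s geometric decay in the
  number of `M`-cube steps, at A = 0, uniformly in the mesh and the box.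

HONEST FRAMING: [folklore] assembly; A = 0 only (no background field, no covariant derivative, no gauge group), ONE scale (no multi-scale
factor `M^{−½|ω|}`, no Hölder norms of B4 §3, no `δG` clause), boxes aligned with the cube lattice; the decay rate is B4's SHAPE with crude
explicit constants, not optimised; nothing of Bałaban's beyond (1.6)/(1.8)/(2.2)–(2.13) at A = 0 is touched; no `sorry`.  Census: cell
K1-lin(s)'s «template application» — the random-walk half — typed at the abstract level (files 1–4) and instantiated for the s = 0 endpoint
`P₀` at U = 1; the two-cutoff line's extended operator is NOT instantiated (located obstruction: block-constant fluctuation cut-offs; fix =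
weighted source norm — successor).  NO letter ∕ tag ∕ size of NE7 moves; NE7 NOT PRINTED ∕ NOT PROVED; spine 0∕9; FIXED FINITE T⁴, rung (B)+1;
NOT infinite volume, NOT mass gap, NOT Clay.  HONEST DEPENDENCY: continuum YM on T⁴ ⇐ BetaPertH ∧ nine spine estimates (0/9 proved); BetaPertH
⇐ (D1) ∧ (D4) ∧ CAP+tail; G-an2-4 gates asym, D1 and NE2/3/4.
-/

noncomputable section

open Finset Matrix
open scoped Matrix.Norms.L2Operator

namespace Summit.QuantumFields.BalabanUV.T4Continuum.NE7K1LinWalkFineOp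

open NE7K1LinWalkParametrix NE7K1LinWalkSmallness NE7K1LinWalkExpansion NE7K1LinWalkCommutator NE7K1LinWalkProfile
  NE7K1LinWalkCubes NE7K1LinWalkBox
open Literature.MathematicalPhysics.QuantumFieldTheory.Balaban1983to89
open Literature.MathematicalPhysics.QuantumFieldTheory.Balaban1983to89.B4Reflection242
open Literature.MathematicalPhysics.QuantumFieldTheory.Balaban1983to89.B4BoxCov237
open Literature.MathematicalPhysics.QuantumFieldTheory.Balaban1983to89.B4Lower18

variable {d : ℕ}

/-! ### §1 The data of the instance -/

/-- the aligned box `Π_μ[0,(2K_μ+1)Mn)`. [folklore] -/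
def boxR (n M : ℕ) (K : Fin (d + 1) → ℕ) : Finset (Fin (d + 1) → ℤ) := boxDom fun μ => (2 * K μ + 1) * (M * n)

/-- the label set `Π_μ{0, …, K_μ}`. [folklore] -/
def labs (K : Fin (d + 1) → ℕ) : Finset (Fin (d + 1) → ℕ) := Fintype.piFinset fun μ => Finset.range (K μ + 1)

/-- the labels, as a finite type. [folklore] -/
abbrev Lab (K : Fin (d + 1) → ℕ) : Type := ↥(labs K)

/-- positions of the labels in `ℤ^{d+1}`. [folklore] -/
def labPos (K : Fin (d + 1) → ℕ) (J : Lab K) : Fin (d + 1) → ℤ := fun μ => (J.1 μ : ℤ)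

/-- the smooth cut-offs `l_J = cut (Mn) J` restricted to the box. [cite: Balaban1983RegularityDecay, (2.2) p.575 «h_j», dictionary] [folklore] -/
def cutR (n M : ℕ) (K : Fin (d + 1) → ℕ) (J : Lab K) : ↥(boxR n M K) → ℝ := fun x => cut (M * n) J.1 x.1

/-- the regions `S_J` (support cube + range margin `n`). [cite: Balaban1983RegularityDecay, (2.2) p.575 «□_j», dictionary] [folklore] -/
def regR (n M : ℕ) (K : Fin (d + 1) → ℕ) (J : Lab K) : Finset ↥(boxR n M K) := region (boxR n M K) (M * n) n J.1

/-- the indicator cut-offs `r_J = 1_{S_J}`. [folklore] -/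
def indR (n M : ℕ) (K : Fin (d + 1) → ℕ) (J : Lab K) : ↥(boxR n M K) → ℝ := fun x => if x ∈ regR n M K J then 1 else 0

/-- the mesh-free (H-comm) constants: `α² = 192(d+1)∕M²`. [folklore] -/
def alpha2 (d M : ℕ) : ℝ := 192 * ((d : ℝ) + 1) / (M : ℝ) ^ 2

/-- `β² = 3(1024(d+1)²∕M⁴ + 16a²(d+1)²∕M²)`. [folklore] -/
def beta2 (d M : ℕ) (a : ℝ) : ℝ := 3 * (1024 * ((d : ℝ) + 1) ^ 2 / (M : ℝ) ^ 4 + 16 * a ^ 2 * ((d : ℝ) + 1) ^ 2 / (M : ℝ) ^ 2)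

/-- the walk parameter `τ = √(α²∕σ′ + β²∕σ′²)`, `σ′ = min(min(2,a),1)`. [folklore] -/
def tau (d M : ℕ) (a : ℝ) : ℝ := Real.sqrt (alpha2 d M / min (min 2 a) 1 + beta2 d M a / (min (min 2 a) 1) ^ 2)

/-! ### §2 The hypotheses of the abstract expansion, discharged -/

section Hyps

variable {n M : ℕ} (hn : 1 ≤ n) (hM : 3 ≤ M) (K : Fin (d + 1) → ℕ) {a : ℝ} (ha : 0 < a)

include hn in
/-- the box is a union of `n`-blocks. [folklore] -/
theorem boxR_isBlockUnion (M : ℕ) (K : Fin (d + 1) → ℕ) : IsBlockUnion n (boxR n M K) := by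
  have : (fun μ : Fin (d + 1) => (2 * K μ + 1) * (M * n)) = fun μ => n * ((2 * K μ + 1) * M) := funext fun μ => by ring
  rw [boxR, this]
  exact boxDom_isBlockUnion hn _

include hn ha in
/-- **COERCIVITY** `min(2,a)` (B4 (1.8) at A = 0, `B4Lower18.lower18_zero`). [cite: Balaban1983RegularityDecay, p.573 (1.8), case A = 0] [folklore] -/
theorem fineOpR_coercive_box (M : ℕ) (K : Fin (d + 1) → ℕ) (g : ↥(boxR n M K) → ℝ) :
    min 2 a * (g ⬝ᵥ g) ≤ g ⬝ᵥ fineOpR n a 0 (boxR n M K) *ᵥ g :=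
  lower18_zero hn ha.le (boxR_isBlockUnion hn M K) g

/-- positions are injective. [folklore] -/
theorem labPos_injective : Function.Injective (labPos K) := by
  intro J J' h
  apply Subtype.ext; funext μ
  have := congrFun h μ
  simp only [labPos] at this
  exact_mod_cast this

include hn hM in
/-- `1 ≤ W = Mn`, `2 ≤ W`, `2n < W`. [folklore] -/
theorem scale_facts : 1 ≤ M * n ∧ 2 ≤ M * n ∧ 2 * n < M * n := by
  refine ⟨?_, ?_, ?_⟩ <;> nlinarith

include hn in
/-- **THE CUT-OFFS LIVE ON THEIR REGIONS** (both clauses of `CutoffOn`, from the range `n` of `fineOpR`). [folklore] -/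
theorem cutoffOn_cutR (hW : 1 ≤ M * n) (J : Lab K) : CutoffOn (fineOpR n a 0 (boxR n M K)) (cutR n M K J) (regR n M K J) := by
  refine ⟨fun x hx => mem_region_self_of_cut_ne_zero hW hx, fun x y hx hy => ?_⟩
  constructor
  · by_contra h
    exact hy (mem_region_of_cut_ne_zero hW hx fun μ => fineOpR_ne_zero_close hn h μ)
  · by_contra h
    exact hy (mem_region_of_cut_ne_zero hW hx fun μ => by rw [abs_sub_comm]; exact fineOpR_ne_zero_close hn h μ)

/-- `l_J · r_J = l_J` pointwise. [folklore] -/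
theorem cutR_mul_indR (hW : 1 ≤ M * n) (J : Lab K) (x : ↥(boxR n M K)) : cutR n M K J x * indR n M K J x = cutR n M K J x := by
  by_cases h : cutR n M K J x = 0
  · rw [h, zero_mul]
  · have hx : x ∈ regR n M K J := mem_region_self_of_cut_ne_zero hW h
    simp only [indR, if_pos hx, mul_one]

/-- **PARTITION OF UNITY** `Σ_J l_J r_J ≡ 1` on the box. [folklore] -/
theorem sum_cutR_mul_indR (hW : 1 ≤ M * n) (x : ↥(boxR n M K)) : ∑ J : Lab K, cutR n M K J x * indR n M K J x = 1 := by
  simp_rw [cutR_mul_indR K hW]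
  have e : ∑ J : Lab K, cutR n M K J x = ∑ J ∈ labs K, cut (M * n) J x.1 :=
    Finset.sum_coe_sort (labs K) (fun J' => cut (M * n) J' x.1)
  rw [e]
  exact sum_cut_eq_one hW K x.2

/-- `|l_J| ≤ 1`, `|r_J| ≤ 1`, `r_J ≠ 0 ⇒` in the region. [folklore] -/
theorem cutR_indR_bounds (J : Lab K) (x : ↥(boxR n M K)) :
    |cutR n M K J x| ≤ 1 ∧ |indR n M K J x| ≤ 1 ∧ (indR n M K J x ≠ 0 → x ∈ regR n M K J) := by
  refine ⟨abs_cut_le_one _ _ _, ?_, ?_⟩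
  · unfold indR; split_ifs <;> simp
  · unfold indR; split_ifs with h
    · exact fun _ => h
    · simp

/-- **DISJOINTNESS** of non-adjacent regions (`2n < Mn`). [folklore] -/
theorem disjoint_regR (hρ : 2 * n < M * n) {J J' : Lab K} (h : ¬ B4RandomWalk213.cubeAdj (labPos K) J J') :
    Disjoint (regR n M K J) (regR n M K J') :=
  disjoint_region hρ h

/-- **OVERLAP NUMBER `≤ 3^{d+1}`**: a region meets at most `3^{d+1}` regions (`B4RandomWalk213.card_cubeAdj_le`). [folklore] -/
theorem count_overlap_le (hρ : 2 * n < M * n) (J : Lab K) :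
    (univ.filter fun J' : Lab K => ¬ Disjoint (regR n M K J) (regR n M K J')).card ≤ 3 ^ (d + 1) := by
  classical
  have hadj := B4RandomWalk213.card_cubeAdj_le (labPos K) (labPos_injective K)
  refine le_trans (Finset.card_le_card fun J' hJ' => ?_) (hadj J)
  rw [Finset.mem_filter] at hJ' ⊢
  refine ⟨Finset.mem_univ _, ?_⟩
  obtain ⟨y, hy, hy'⟩ := Finset.not_disjoint_iff.mp hJ'.2
  exact labelAdj_of_mem_region hρ hy hy'

/-- **COVERING NUMBERS `≤ 3^{d+1}`**: at most `3^{d+1}` regions (resp. cut-off supports) contain a given site. [folklore] -/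
theorem count_cover_le (hρ : 2 * n < M * n) (x : ↥(boxR n M K)) :
    (univ.filter fun J' : Lab K => indR n M K J' x ≠ 0).card ≤ 3 ^ (d + 1) ∧
      (univ.filter fun J' : Lab K => cutR n M K J' x ≠ 0).card ≤ 3 ^ (d + 1) := by
  classical
  have hadj := B4RandomWalk213.card_cubeAdj_le (labPos K) (labPos_injective K)
  have hW : 1 ≤ M * n := by omega
  refine ⟨?_, ?_⟩
  · by_cases hne : (univ.filter fun J' : Lab K => indR n M K J' x ≠ 0).Nonempty
    · obtain ⟨J₀, hJ₀⟩ := hne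
      have hx₀ : x ∈ regR n M K J₀ := ((cutR_indR_bounds K J₀ x).2.2) (Finset.mem_filter.mp hJ₀).2
      refine le_trans (Finset.card_le_card fun J' hJ' => ?_) (hadj J₀)
      rw [Finset.mem_filter] at hJ' ⊢
      exact ⟨Finset.mem_univ _, labelAdj_of_mem_region hρ hx₀ (((cutR_indR_bounds K J' x).2.2) hJ'.2)⟩
    · rw [Finset.not_nonempty_iff_eq_empty.mp hne, Finset.card_empty]; positivity
  · by_cases hne : (univ.filter fun J' : Lab K => cutR n M K J' x ≠ 0).Nonempty
    · obtain ⟨J₀, hJ₀⟩ := hne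
      have hx₀ : x ∈ regR n M K J₀ := mem_region_self_of_cut_ne_zero hW (Finset.mem_filter.mp hJ₀).2
      refine le_trans (Finset.card_le_card fun J' hJ' => ?_) (hadj J₀)
      rw [Finset.mem_filter] at hJ' ⊢
      exact ⟨Finset.mem_univ _, labelAdj_of_mem_region hρ hx₀ (mem_region_self_of_cut_ne_zero hW hJ'.2)⟩
    · rw [Finset.not_nonempty_iff_eq_empty.mp hne, Finset.card_empty]; positivity

include hn ha in
/-- **(H-comm) WITH MESH-FREE CONSTANTS**: `‖[diag(l_J), P]v‖² ≤ α²⟨v,Pv⟩ + β²‖v‖²`, `α² = 192(d+1)∕M²`, `β² = 3(1024(d+1)²∕M⁴ + 16a²(d+1)²∕M²)`.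
[cite: Balaban1983RegularityDecay, (2.3) p.575 + Lemma 2.1 (2.15) p.577, case A = 0] [folklore] -/
theorem hcomm_cutR (hW2 : 2 ≤ M * n) (J : Lab K) (v : ↥(boxR n M K) → ℝ) :
    comm (cutR n M K J) (fineOpR n a 0 (boxR n M K)) *ᵥ v ⬝ᵥ comm (cutR n M K J) (fineOpR n a 0 (boxR n M K)) *ᵥ v ≤
      alpha2 d M * (v ⬝ᵥ fineOpR n a 0 (boxR n M K) *ᵥ v) + beta2 d M a * (v ⬝ᵥ v) := by
  have hW : 1 ≤ M * n := le_trans (by norm_num) hW2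
  have hn0 : (0 : ℝ) < n := by exact_mod_cast hn
  have hM0 : (0 : ℝ) < M := by
    have : 1 ≤ M := by nlinarith
    exact_mod_cast this
  have hWr : ((M * n : ℕ) : ℝ) = (M : ℝ) * n := by push_cast; ring
  have h := comm_mulVec_sq_le_fineOpR hn (boxR_isBlockUnion hn M K) ha.le (cutR n M K J)
    (ℓ₁ := 4 / ((M * n : ℕ) : ℝ)) (ℓ₂ := 32 * ((d : ℝ) + 1) / ((M * n : ℕ) : ℝ) ^ 2) (ℓ₃ := 4 * ((d : ℝ) + 1) * n / ((M * n : ℕ) : ℝ))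
    (by positivity) (by positivity)
    (fun x y hxy => abs_cut_sub_cut_of_mem_nbrs hW J.1 hxy)
    (fun x => abs_sum_nbrs_cut_sub_le hW2 K J.1 x)
    (fun x y hxy => abs_cut_sub_cut_of_blk_eq hW hn J.1 hxy) v
  have hform : 0 ≤ v ⬝ᵥ fineOpR n a 0 (boxR n M K) *ᵥ v :=
    le_trans (mul_nonneg (le_min zero_le_two ha.le) (Finset.sum_nonneg fun i _ => mul_self_nonneg _))
      (fineOpR_coercive_box hn ha M K v)
  have hvv : 0 ≤ v ⬝ᵥ v := Finset.sum_nonneg fun i _ => mul_self_nonneg _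
  refine h.trans (le_of_eq ?_)
  simp only [alpha2, beta2, hWr]
  field_simp
  ring

end Hyps

/-! ### §3 B4 (2.12)–(2.13) and (2.22) at A = 0 on the aligned box -/

/-- the remainder is small: `‖R‖ ≤ 3^{d+1}·τ`. [cite: Balaban1983RegularityDecay, p.577 after (2.12), case A = 0] [folklore] -/
theorem l2_opNorm_remainder_box {n M : ℕ} (hn : 1 ≤ n) (hM : 3 ≤ M) (K : Fin (d + 1) → ℕ) {a : ℝ} (ha : 0 < a) :
    ‖∑ J : Lab K, bPiece (fineOpR n a 0 (boxR n M K)) (cutR n M K J) (indR n M K J) (regR n M K J)‖ ≤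
      (3 : ℝ) ^ (d + 1) * tau d M a := by
  classical
  obtain ⟨hW, hW2, hρ⟩ := scale_facts hn hM
  have hσ : 0 < min 2 a := lt_min two_pos ha
  have hα : 0 ≤ alpha2 d M := by unfold alpha2; positivity
  have hβ : 0 ≤ beta2 d M a := by unfold beta2; positivity
  have h := l2_opNorm_remainder_le (fineOpR n a 0 (boxR n M K)) hσ (fineOpR_coercive_box hn ha M K)
    (cutR n M K) (indR n M K) (regR n M K) (cutoffOn_cutR hn K hW) (fun J x => (cutR_indR_bounds K J x).2.2)
    (fun J x => (cutR_indR_bounds K J x).2.1) hα hβ (hcomm_cutR hn K ha hW2)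
    (fun J => count_overlap_le K hρ J) (fun x => (count_cover_le K hρ x).1)
  refine h.trans (le_of_eq ?_)
  rw [tau, ← Real.sqrt_sq (by positivity : (0 : ℝ) ≤ (3 : ℝ) ^ (d + 1)), ← Real.sqrt_mul (by positivity)]
  congr 1; push_cast; ring

/-- **B4 (2.12)–(2.13) AT `A = 0`, CONVERGENT**: for `3^{d+1}·τ < 1` the random-walk expansion of `G_k(Ω,0) = (fineOpR n a 0 R)⁻¹` over the
`M`-cubes of the aligned box `R` converges in the `ℓ²`-operator norm: `HasSum (n ↦ G₀Rⁿ) G_k(Ω,0)` — uniformly in the mesh `1∕n` and in the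
box (the threshold depends on `d` and `a` only). [cite: Balaban1983RegularityDecay, (2.12)–(2.13) p.577, case A = 0] [folklore] -/
theorem hasSum_fineOpR_walk {n M : ℕ} (hn : 1 ≤ n) (hM : 3 ≤ M) (K : Fin (d + 1) → ℕ) {a : ℝ} (ha : 0 < a)
    (hsmall : (3 : ℝ) ^ (d + 1) * tau d M a < 1) :
    HasSum (fun k : ℕ => (∑ J : Lab K, aPiece (fineOpR n a 0 (boxR n M K)) (cutR n M K J) (indR n M K J) (regR n M K J)) *
        (∑ J : Lab K, bPiece (fineOpR n a 0 (boxR n M K)) (cutR n M K J) (indR n M K J) (regR n M K J)) ^ k)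
      (fineOpR n a 0 (boxR n M K))⁻¹ := by
  obtain ⟨hW, -, -⟩ := scale_facts hn hM
  exact hasSum_walk_expansion _ (lt_min two_pos ha) (fineOpR_coercive_box hn ha M K) _ _ _ (cutoffOn_cutR hn K hW)
    (sum_cutR_mul_indR K hW) ((l2_opNorm_remainder_box hn hM K ha).trans_lt hsmall)

/-- **B4 (2.22)∕(2.30) AT `A = 0` — GEOMETRIC DECAY OF `G_k(Ω,0)` ACROSS `M`-CUBES, UNIFORMLY IN THE MESH AND THE BOX**: for `3^{d+1}τ < 1` and
sites `x, y` of the aligned box with `|x_μ − y_μ| ≥ (2N+3)Mn + n` in some coordinate (`N ≥ 1`),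
`|G_k(Ω,0)(x,y)| ≤ 3^{d+1}·(min(min(2,a),1))⁻¹·τ·3^{d+1}·(3^{d+1}τ)^{N−1}∕(1 − 3^{d+1}τ)`. [cite: Balaban1983RegularityDecay, (2.22) p.579, Corollary 2.3 (2.30) pp.580–581, case A = 0] [folklore] -/
theorem fineOpR_inv_entry_decay {n M : ℕ} (hn : 1 ≤ n) (hM : 3 ≤ M) (K : Fin (d + 1) → ℕ) {a : ℝ} (ha : 0 < a)
    (hsmall : (3 : ℝ) ^ (d + 1) * tau d M a < 1) (x y : ↥(boxR n M K)) {N : ℕ} (hN : 1 ≤ N)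
    (hfar : ∃ μ, (((2 * N + 3) * (M * n) + n : ℕ) : ℤ) ≤ |x.1 μ - y.1 μ|) :
    |(fineOpR n a 0 (boxR n M K))⁻¹ x y| ≤
      (3 : ℝ) ^ (d + 1) * (1 / min (min 2 a) 1) * tau d M a * (3 : ℝ) ^ (d + 1) *
        ((3 : ℝ) ^ (d + 1) * tau d M a) ^ (N - 1) / (1 - (3 : ℝ) ^ (d + 1) * tau d M a) := by
  classical
  obtain ⟨hW, hW2, hρ⟩ := scale_facts hn hM
  have hσ : 0 < min 2 a := lt_min two_pos ha
  have hα : 0 ≤ alpha2 d M := by unfold alpha2; positivity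
  have hβ : 0 ≤ beta2 d M a := by unfold beta2; positivity
  obtain ⟨μ, hμ⟩ := hfar
  have h := inv_entry_decay (labPos K) (labPos_injective K) (fineOpR n a 0 (boxR n M K)) hσ (fineOpR_coercive_box hn ha M K)
    (cutR n M K) (indR n M K) (regR n M K) (fun J J' hJJ' => disjoint_regR K hρ hJJ') (cutoffOn_cutR hn K hW) (sum_cutR_mul_indR K hW)
    zero_le_one (fun J x => (cutR_indR_bounds K J x).1) (fun J x => (cutR_indR_bounds K J x).2.2)
    (fun J x => (cutR_indR_bounds K J x).2.1) hα hβ (hcomm_cutR hn K ha hW2) (by rw [tau] at hsmall; exact hsmall)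
    ((l2_opNorm_remainder_box hn hM K ha).trans_lt hsmall) x y (count_cover_le K hρ x).2 hN
    (fun J hJ J' hJ' => ⟨μ, label_sep_of_far hW hJ (((cutR_indR_bounds K J' y).2.2) hJ') (by exact_mod_cast hμ)⟩)
  rw [tau]
  refine h.trans (le_of_eq ?_)
  push_cast
  ring

end Summit.QuantumFields.BalabanUV.T4Continuum.NE7K1LinWalkFineOp

end
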